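import Summits.Ventures.YMGap.RobustBall.ZNFluxWindowLayer
import HarnessLib

/-!
# RobustBall/ZNFluxWindowPeeling — WINDOWED Durhuus–Fröhlich peeling for `ℤ_N` lattice gauge theories with
# finite-range flux interactions: `‖⟨ψ(∮_{∂R×T} k)⟩‖ ≤ (4 c^{⌈T/s⌉})^{#{r < R : m ∣ r}}`

HONEST FRAMING: venture file of the cell `pub-ymgap` (QuantumFields programme), track Y2 ROBUST-BALL, seat ds-4 g8.
Finite sums on a finite torus — a UNIFORM AREA-LAW BOUND FOR `ℤ_N` LATTICE GAUGE THEORIES WITH ARBITRARY FINITE-RANGE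
FLUX INTERACTIONS `exp(∑_t g_t(flux|_{supp t}))` (`|g_t| ≤ B_t`): if every term's `i`-links lie within cyclic
`i`-distance `< m` of each other (vertical window) and within `j`-distance `≤ s` (transverse extent), and the Dobrushin
row sums `∑_{t ∋ y} B_t (|iLinks i (supp t)| − 1)` are `≤ c ≤ 1`, then for every non-wrapping `R × T` rectangle in the
`(i, j)` plane (`2R, 2T ≤ L`), `‖⟨ψ(∮ k)⟩‖ ≤ (4 c^{⌈T/s⌉})^{#{r < R : m ∣ r}}` (`norm_cavg_ψ_loopSum_le_window`), every
`N ≥ 2`.  Mechanism (Durhuus–Fröhlich 1980 / Mack–Petkova 1979 §2 with a vertical window, as in rb-p2's tier-1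
peeling): condition on the transverse links (`ZN.sum_eq_sum_sum_glue`) AND on the `i`-links off the selected heights
`x_i + r`, `m ∣ r` (block conditioning `ZNSpin.norm_cavg_le_of_piecewise`); the unselected rungs and the transverse
sides are then unimodular constants, no term touches two selected layers (they are `≥ m` apart), so the conditioned
weight factorises over the selected layers (`FiniteGibbs.cavg_mul_eq_of_dependsOn`) and each selected rung contributes
`≤ 4 c^{⌈T/s⌉}` (`ZNFluxW.norm_cavg_ψ_sub_le_window`).  At `m = s = 1` with single-plaquette supports this is
`ZNFluxPeeling`.  No `SU(N)` measure and nothing about the continuum here.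
-/

noncomputable section

open Finset Function
open Literature.MathematicalPhysics.QuantumFieldTheory

namespace Summit.Ventures.YMGap.RobustBall

namespace ZNFluxW

open ZN

variable {d L N : ℕ} [NeZero L] [NeZero N] {ι : Type*} [Fintype ι]

/-! ### Selected rungs and heights -/

/-- The selected rung indices: multiples of `m` below `n`. [folklore] -/
def selIdx (m n : ℕ) : Finset ℕ := (Finset.range n).filter fun r => m ∣ r

/-- The selected `i`-heights `x_i + r`, `r ∈ selIdx m R`. [folklore] -/
def selH (x : Site d L) (i : Fin d) (m R : ℕ) : Finset (ZMod L) := (selIdx m R).image fun r : ℕ => x i + (r : ZMod L)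

/-- The selected rung sum `∑_{r < n, m ∣ r} (σ(bot r) − σ(top r))`. [folklore] -/
def rungSel (m : ℕ) (x : Site d L) (i j : Fin d) (T n : ℕ) (σ : Site d L → ZMod N) : ZMod N :=
  ∑ r ∈ selIdx m n, (σ (bot x i r) - σ (top x i j T r))

omit [NeZero L] in
/-- The `i`-height of a bottom rung site. [folklore] -/
@[simp] theorem bot_apply (x : Site d L) (i : Fin d) (r : ℕ) : bot x i r i = x i + (r : ZMod L) := by simp [bot]

omit [NeZero L] in
/-- The `i`-height of a top rung site. [folklore] -/
@[simp] theorem top_apply {i j : Fin d} (hij : i ≠ j) (x : Site d L) (T r : ℕ) :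
    top x i j T r i = x i + (r : ZMod L) := by simp [top, Pi.single_eq_of_ne hij]

omit [NeZero L] in
/-- Heights `x_i + r`, `r < L`, are pairwise distinct. [folklore] -/
theorem natCast_inj_of_lt {r r' : ℕ} (hr : r < L) (hr' : r' < L) (h : ((r : ℕ) : ZMod L) = ((r' : ℕ) : ZMod L)) :
    r = r' := by
  rw [ZMod.natCast_eq_natCast_iff', Nat.mod_eq_of_lt hr, Nat.mod_eq_of_lt hr'] at h
  exact h

omit [NeZero L] in
/-- Membership of a height `x_i + r` (`r < R ≤ L`) in the selected heights. [folklore] -/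
theorem mem_selH_iff (x : Site d L) (i : Fin d) {m R r : ℕ} (hRL : R ≤ L) (hr : r < R) :
    x i + (r : ZMod L) ∈ selH x i m R ↔ m ∣ r := by
  rw [selH, Finset.mem_image]
  constructor
  · rintro ⟨r', hr', h⟩
    rw [selIdx, Finset.mem_filter, Finset.mem_range] at hr'
    have := natCast_inj_of_lt (L := L) (by omega) (by omega) (add_left_cancel h)
    exact this ▸ hr'.2
  · intro h
    exact ⟨r, Finset.mem_filter.2 ⟨Finset.mem_range.2 hr, h⟩, rfl⟩

omit [NeZero L] in
/-- **Distinct selected heights are `≥ m` apart** in cyclic `i`-distance (`2R ≤ L`). [folklore] -/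
theorem le_dist_of_mem_selIdx {m R r r' : ℕ} (hRL : 2 * R ≤ L) (hr : r ∈ selIdx m R) (hr' : r' ∈ selIdx m R)
    (hne : r ≠ r') : m ≤ (((r : ℕ) : ZMod L) - ((r' : ℕ) : ZMod L)).valMinAbs.natAbs := by
  rw [selIdx, Finset.mem_filter, Finset.mem_range] at hr hr'
  obtain ⟨hrR, a, rfl⟩ := hr
  obtain ⟨hr'R, b, rfl⟩ := hr'
  have hab : a ≠ b := fun h => hne (by rw [h])
  rcases lt_or_gt_of_ne hab with h | h
  · -- r < r'
    have hd : ((m * a : ℕ) : ZMod L) - ((m * b : ℕ) : ZMod L) = -(((m * b - m * a : ℕ) : ℕ) : ZMod L) := by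
      have : m * a ≤ m * b := Nat.mul_le_mul_left m h.le
      rw [Nat.cast_sub this]; ring
    rw [hd, ZMod.natAbs_valMinAbs_neg, ZMod.valMinAbs_natCast_of_le_half (by omega)]
    simp only [Int.natAbs_natCast]
    rw [← Nat.mul_sub]
    exact Nat.le_mul_of_pos_right m (by omega)
  · have hd : ((m * a : ℕ) : ZMod L) - ((m * b : ℕ) : ZMod L) = (((m * a - m * b : ℕ) : ℕ) : ZMod L) := by
      have : m * b ≤ m * a := Nat.mul_le_mul_left m h.le
      rw [Nat.cast_sub this]
    rw [hd, ZMod.valMinAbs_natCast_of_le_half (by omega)]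
    simp only [Int.natAbs_natCast]
    rw [← Nat.mul_sub]
    exact Nat.le_mul_of_pos_right m (by omega)

/-! ### The selected rung sum on the block -/

omit [NeZero N] in
/-- **On the block the rung sum splits**: selected rungs read the free spins `σ`, the other rungs read the frozen `κ`. [folklore] -/
theorem rung_piecewise {i j : Fin d} (hij : i ≠ j) (x : Site d L) (T : ℕ) {m R : ℕ} (hRL : 2 * R ≤ L)
    (σ κ : Site d L → ZMod N) :
    rung x i j T R ((block i (selH x i m R)).piecewise σ κ) =
      rungSel m x i j T R σ + ∑ r ∈ (Finset.range R).filter (fun r => ¬m ∣ r), (κ (bot x i r) - κ (top x i j T r)) := by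
  classical
  rw [rung, rungSel, selIdx, ← Finset.sum_filter_add_sum_filter_not (Finset.range R) (fun r => m ∣ r)]
  congr 1
  · refine Finset.sum_congr rfl fun r hr => ?_
    rw [Finset.mem_filter, Finset.mem_range] at hr
    have hb : bot x i r ∈ block i (selH x i m R) := by
      rw [mem_block, bot_apply, mem_selH_iff x i (by omega) hr.1]; exact hr.2
    have ht : top x i j T r ∈ block i (selH x i m R) := by
      rw [mem_block, top_apply hij, mem_selH_iff x i (by omega) hr.1]; exact hr.2
    rw [Finset.piecewise_eq_of_mem _ _ _ hb, Finset.piecewise_eq_of_mem _ _ _ ht]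
  · refine Finset.sum_congr rfl fun r hr => ?_
    rw [Finset.mem_filter, Finset.mem_range] at hr
    have hb : bot x i r ∉ block i (selH x i m R) := by
      rw [mem_block, bot_apply, mem_selH_iff x i (by omega) hr.1]; exact hr.2
    have ht : top x i j T r ∉ block i (selH x i m R) := by
      rw [mem_block, top_apply hij, mem_selH_iff x i (by omega) hr.1]; exact hr.2
    rw [Finset.piecewise_eq_of_notMem _ _ _ hb, Finset.piecewise_eq_of_notMem _ _ _ ht]

/-! ### Factorisation over the selected layers -/

section Factor

variable {supp : ι → Finset (Plaquette d L)} {g : ι → (Plaquette d L → ZMod N) → ℝ}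
  (hdep : ∀ t, DependsOn (g t) (↑(supp t) : Set (Plaquette d L))) (i j : Fin d) (hij : i ≠ j) {m : ℕ}
  (hwin : ∀ t, ∀ y ∈ iLinks i (supp t), ∀ y' ∈ iLinks i (supp t), (y i - y' i).valMinAbs.natAbs < m)
  (x : Site d L) (R T : ℕ) (hRL : 2 * R ≤ L) (kT : Transverse d L (ZMod N) i) (κ : Site d L → ZMod N)

include hdep hij hwin hRL in
/-- **The selected-rung average factorises over the selected rungs**: no term touches two selected layers, so under
the block-conditioned weight the selected layers are independent. [folklore] -/
theorem cavg_ψ_rungSel_eq_prod :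
    ∀ n : ℕ, n ≤ R →
      FiniteGibbs.cavg (layerWeightW g i (selH x i m R) kT κ) (fun σ => ψ N (rungSel m x i j T n σ)) =
        ∏ r ∈ selIdx m n, FiniteGibbs.cavg (layerWeightW g i (selH x i m R) kT κ)
          (fun σ => ψ N (σ (bot x i r) - σ (top x i j T r)))
  | 0, _ => by
      have h0 : selIdx m 0 = ∅ := by simp [selIdx]
      simp only [rungSel, h0, Finset.sum_empty, Finset.prod_empty, ψ_zero]
      rw [FiniteGibbs.cavg]
      have hm : (FiniteGibbs.mass (layerWeightW g i (selH x i m R) kT κ) : ℂ) ≠ 0 := by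
        rw [Ne, Complex.ofReal_eq_zero]
        exact (FiniteGibbs.mass_pos_of_pos (layerWeightW_pos g i _ kT κ)).ne'
      simp only [mul_one]
      rw [show (∑ σ : Site d L → ZMod N, (layerWeightW g i (selH x i m R) kT κ σ : ℂ)) =
          (FiniteGibbs.mass (layerWeightW g i (selH x i m R) kT κ) : ℂ) by
        rw [FiniteGibbs.mass]; push_cast; rfl, div_self hm]
  | n + 1, hn => by
      classical
      have ih := cavg_ψ_rungSel_eq_prod n (Nat.le_of_succ_le hn)
      by_cases hmn : ¬m ∣ n
      · -- rung `n` is not selected: nothing changes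
        have hsel : selIdx m (n + 1) = selIdx m n := by
          rw [selIdx, selIdx, Finset.range_add_one, Finset.filter_insert, if_neg hmn]
        have hrs : (fun σ : Site d L → ZMod N => ψ N (rungSel m x i j T (n + 1) σ)) =
            fun σ => ψ N (rungSel m x i j T n σ) := by
          funext σ; rw [rungSel, rungSel, hsel]
        rw [hrs, hsel, ih]
      rw [not_not] at hmn
      have hnot : n ∉ selIdx m n := by simp [selIdx]
      have hsel : selIdx m (n + 1) = insert n (selIdx m n) := by
        rw [selIdx, selIdx, Finset.range_add_one, Finset.filter_insert, if_pos hmn]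
      rw [hsel, Finset.prod_insert hnot, ← ih]
      -- the layer of rung `n`
      set blk := block i (selH x i m R) with hblk
      set w := layerWeightW g i (selH x i m R) kT κ with hw
      set Bn : Finset (Site d L) := Finset.univ.filter fun y => y i = x i + ((n : ℕ) : ZMod L) with hBn
      set touch : ι → Prop := fun t => ∃ y ∈ iLinks i (supp t), y i = x i + ((n : ℕ) : ZMod L) with htouch
      set φ : ι → (Site d L → ZMod N) → ℝ := fun t σ => g t (flux (glue i (blk.piecewise σ κ) kT)) with hφ
      set u : (Site d L → ZMod N) → ℝ := fun σ => Real.exp (∑ t ∈ Finset.univ.filter touch, φ t σ) with hu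
      set v : (Site d L → ZMod N) → ℝ := fun σ => Real.exp (∑ t ∈ Finset.univ.filter (fun t => ¬touch t), φ t σ)
        with hv
      have hwuv : w = fun σ => u σ * v σ := by
        funext σ
        rw [hu, hv]; dsimp only
        rw [← Real.exp_add, Finset.sum_filter_add_sum_filter_not]
        rfl
      have hBmem : ∀ y : Site d L, y ∈ (↑Bn : Set (Site d L)) ↔ y i = x i + ((n : ℕ) : ZMod L) := fun y => by
        rw [Finset.mem_coe, hBn, Finset.mem_filter]; simp
      have hnR : n < R := hn
      have hnsel : n ∈ selIdx m R := Finset.mem_filter.2 ⟨Finset.mem_range.2 hnR, hmn⟩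
      -- terms touching layer `n` read `σ` only on layer `n`
      have hdepU : DependsOn u (↑Bn : Set (Site d L)) := by
        intro σ σ' hσ
        simp only [hu]
        congr 1
        refine Finset.sum_congr rfl fun t ht => ?_
        obtain ⟨y₀, hy₀, hy₀i⟩ := (Finset.mem_filter.1 ht).2
        refine apply_flux_glue_congr hdep t i kT fun y hy => ?_
        by_cases hyb : y ∈ blk
        · -- a selected height within the window of a term touching layer `n` IS layer `n`
          have hyH : y i ∈ selH x i m R := mem_block.1 hyb
          obtain ⟨r', hr', hyr'⟩ := Finset.mem_image.1 hyH
          have hwin' := hwin t y hy y₀ hy₀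
          have hr'n : r' = n := by
            by_contra hne
            have hle := le_dist_of_mem_selIdx (L := L) hRL hr' hnsel hne
            rw [← hyr', hy₀i, show x i + ((r' : ℕ) : ZMod L) - (x i + ((n : ℕ) : ZMod L)) =
              ((r' : ℕ) : ZMod L) - ((n : ℕ) : ZMod L) by ring] at hwin'
            omega
          have hyBn : y ∈ (↑Bn : Set (Site d L)) := by rw [hBmem, ← hyr', hr'n]
          rw [Finset.piecewise_eq_of_mem _ _ _ hyb, Finset.piecewise_eq_of_mem _ _ _ hyb, hσ y hyBn]
        · rw [Finset.piecewise_eq_of_notMem _ _ _ hyb, Finset.piecewise_eq_of_notMem _ _ _ hyb]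
      -- terms not touching layer `n` do not read layer `n`
      have hdepV : DependsOn v (↑Bn : Set (Site d L))ᶜ := by
        intro σ σ' hσ
        simp only [hv]
        congr 1
        refine Finset.sum_congr rfl fun t ht => ?_
        have hnt : ¬touch t := (Finset.mem_filter.1 ht).2
        refine apply_flux_glue_congr hdep t i kT fun y hy => ?_
        have hyBn : y ∈ (↑Bn : Set (Site d L))ᶜ := by
          rw [Set.mem_compl_iff, hBmem]; exact fun h => hnt ⟨y, hy, h⟩
        by_cases hyb : y ∈ blk
        · rw [Finset.piecewise_eq_of_mem _ _ _ hyb, Finset.piecewise_eq_of_mem _ _ _ hyb, hσ y hyBn]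
        · rw [Finset.piecewise_eq_of_notMem _ _ _ hyb, Finset.piecewise_eq_of_notMem _ _ _ hyb]
      -- the new rung reads layer `n`, the old selected rungs read the other layers
      have hF : DependsOn (fun σ : Site d L → ZMod N => ψ N (σ (bot x i n) - σ (top x i j T n))) (↑Bn : Set (Site d L)) :=
        fun σ σ' h => by
          simp only
          rw [h _ ((hBmem _).2 (bot_apply x i n)), h _ ((hBmem _).2 (top_apply hij x T n))]
      have hne : ∀ r ∈ selIdx m n, x i + ((r : ℕ) : ZMod L) ≠ x i + ((n : ℕ) : ZMod L) := by
        intro r hr h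
        have hrn : r < n := Finset.mem_range.1 (Finset.mem_filter.1 hr).1
        have := natCast_inj_of_lt (L := L) (by omega) (by omega) (add_left_cancel h)
        omega
      have hG : DependsOn (fun σ : Site d L → ZMod N => ψ N (rungSel m x i j T n σ)) (↑Bn : Set (Site d L))ᶜ :=
        fun σ σ' h => by
          simp only [rungSel]
          rw [Finset.sum_congr rfl fun r hr => by
            rw [h _ (by rw [Set.mem_compl_iff, hBmem, bot_apply]; exact hne r hr),
              h _ (by rw [Set.mem_compl_iff, hBmem, top_apply hij]; exact hne r hr)]]
      have hm0 : FiniteGibbs.mass (fun σ => u σ * v σ) ≠ 0 := by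
        rw [← hwuv]; exact (FiniteGibbs.mass_pos_of_pos (layerWeightW_pos g i _ kT κ)).ne'
      have key := FiniteGibbs.cavg_mul_eq_of_dependsOn Bn hdepU hdepV hF hG hm0
      rw [← hwuv] at key
      rw [← key]
      refine congrArg _ (funext fun σ => ?_)
      rw [rungSel, hsel, Finset.sum_insert hnot, ψ_add, ← rungSel]

include hdep hij hwin hRL in
/-- **Windowed layer bound**: under the block-conditioned weight,
`‖E ψ(rung_R ∘ block.piecewise · κ)‖ ≤ (4 c^{⌈T/s⌉})^{#selIdx m R}`. [folklore] -/
theorem norm_cavg_ψ_rung_piecewise_le (hN : 2 ≤ N) {B : ι → ℝ} (hB0 : ∀ t, 0 ≤ B t) (hB : ∀ t φ, |g t φ| ≤ B t)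
    {c : ℝ} (hrow : ∀ y : Site d L, ∑ t ∈ Finset.univ.filter (fun t => y ∈ iLinks i (supp t)),
      B t * (((iLinks i (supp t)).card : ℝ) - 1) ≤ c) (hc1 : c ≤ 1) {s : ℕ} (hs : 0 < s)
    (hext : ∀ t, ∀ y ∈ iLinks i (supp t), ∀ y' ∈ iLinks i (supp t), jDist j y' y ≤ s) (hT : 2 * T ≤ L) :
    ‖FiniteGibbs.cavg (layerWeightW g i (selH x i m R) kT κ)
        (fun σ => ψ N (rung x i j T R ((block i (selH x i m R)).piecewise σ κ)))‖ ≤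
      (4 * c ^ ((T + s - 1) / s)) ^ (selIdx m R).card := by
  classical
  -- the unselected rungs are a unimodular constant
  have hsplit : (fun σ : Site d L → ZMod N => ψ N (rung x i j T R ((block i (selH x i m R)).piecewise σ κ))) =
      fun σ => ψ N (rungSel m x i j T R σ) *
        ψ N (∑ r ∈ (Finset.range R).filter (fun r => ¬m ∣ r), (κ (bot x i r) - κ (top x i j T r))) := by
    funext σ; rw [rung_piecewise hij x T hRL, ψ_add]
  have hconst : FiniteGibbs.cavg (layerWeightW g i (selH x i m R) kT κ)
      (fun σ => ψ N (rungSel m x i j T R σ) *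
        ψ N (∑ r ∈ (Finset.range R).filter (fun r => ¬m ∣ r), (κ (bot x i r) - κ (top x i j T r)))) =
      FiniteGibbs.cavg (layerWeightW g i (selH x i m R) kT κ) (fun σ => ψ N (rungSel m x i j T R σ)) *
        ψ N (∑ r ∈ (Finset.range R).filter (fun r => ¬m ∣ r), (κ (bot x i r) - κ (top x i j T r))) := by
    simp only [FiniteGibbs.cavg]
    rw [div_mul_eq_mul_div, Finset.sum_mul]
    congr 1
    exact Finset.sum_congr rfl fun σ _ => by ring
  rw [hsplit, hconst, norm_mul, norm_ψ, mul_one, cavg_ψ_rungSel_eq_prod hdep i j hij hwin x R T hRL kT κ R le_rfl,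
    norm_prod, ← Finset.prod_const]
  refine Finset.prod_le_prod (fun r _ => norm_nonneg _) fun r _ => ?_
  have h := norm_cavg_ψ_sub_le_window hN hdep hB0 hB i j hrow hc1 hs hext (selH x i m R) kT κ (bot x i r)
    (top x i j T r)
  rwa [profile_rung hij x r T hT] at h

end Factor

/-! ### The uniform windowed bound -/

/-- **UNIFORM AREA-LAW BOUND FOR `ℤ_N` LATTICE GAUGE THEORIES WITH FINITE-RANGE FLUX INTERACTIONS** (`N ≥ 2`): terms
with `DependsOn` plaquette supports, bounds `|g_t| ≤ B_t`, vertical window `m` (cyclic `i`-distance of a term's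
`i`-links `< m`), transverse extent `s ≥ 1` (`j`-distance `≤ s`), Dobrushin row sums `≤ c ≤ 1`; then for every
non-wrapping `R × T` rectangle in the `(i, j)` plane,
`‖⟨ψ(∮_{∂R×T} k)⟩‖ ≤ (4 c^{⌈T/s⌉})^{#{r < R : m ∣ r}}`. [cite: MackPetkova1979, §2] -/
theorem norm_cavg_ψ_loopSum_le_window (hN : 2 ≤ N) {supp : ι → Finset (Plaquette d L)}
    {g : ι → (Plaquette d L → ZMod N) → ℝ} {B : ι → ℝ}
    (hdep : ∀ t, DependsOn (g t) (↑(supp t) : Set (Plaquette d L))) (hB0 : ∀ t, 0 ≤ B t) (hB : ∀ t φ, |g t φ| ≤ B t)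
    {i j : Fin d} (hij : i ≠ j) {m : ℕ}
    (hwin : ∀ t, ∀ y ∈ iLinks i (supp t), ∀ y' ∈ iLinks i (supp t), (y i - y' i).valMinAbs.natAbs < m)
    {c : ℝ} (hrow : ∀ y : Site d L, ∑ t ∈ Finset.univ.filter (fun t => y ∈ iLinks i (supp t)),
      B t * (((iLinks i (supp t)).card : ℝ) - 1) ≤ c) (hc1 : c ≤ 1) {s : ℕ} (hs : 0 < s)
    (hext : ∀ t, ∀ y ∈ iLinks i (supp t), ∀ y' ∈ iLinks i (supp t), jDist j y' y ≤ s)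
    (x : Site d L) {R T : ℕ} (hR : 2 * R ≤ L) (hT : 2 * T ≤ L) :
    ‖FiniteGibbs.cavg (znWD g) (fun k => ψ N (loopSum k x i j R T))‖ ≤
      (4 * c ^ ((T + s - 1) / s)) ^ (selIdx m R).card := by
  classical
  set M := (4 * c ^ ((T + s - 1) / s)) ^ (selIdx m R).card with hM
  have hmass : 0 < FiniteGibbs.mass (znWD (N := N) (L := L) g) := FiniteGibbs.mass_pos_of_pos fun k => Real.exp_pos _
  rw [FiniteGibbs.cavg, norm_div, Complex.norm_real, Real.norm_eq_abs, abs_of_pos hmass, div_le_iff₀ hmass]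
  -- split numerator and mass into transverse and layer sums
  rw [sum_eq_sum_sum_glue i, FiniteGibbs.mass, sum_eq_sum_sum_glue i, Finset.mul_sum]
  refine (norm_sum_le _ _).trans (Finset.sum_le_sum fun kT _ => ?_)
  -- the layer weight given `kT`
  set w : (Site d L → ZMod N) → ℝ := fun kI => znWD g (glue i kI kT) with hw
  have hwpos : ∀ kI, 0 < w kI := fun kI => Real.exp_pos _
  have hwmass : 0 < FiniteGibbs.mass w := FiniteGibbs.mass_pos_of_pos hwpos
  -- on the fibre of `kT` the transverse sides are a unimodular constant
  have hfac : ∑ kI : Site d L → ZMod N, (znWD g (glue i kI kT) : ℂ) * ψ N (loopSum (glue i kI kT) x i j R T) =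
      ψ N (transLine j hij kT T (x + Pi.single i ((R : ℕ) : ZMod L)) - transLine j hij kT T x) *
        ∑ kI : Site d L → ZMod N, (w kI : ℂ) * ψ N (rung x i j T R kI) := by
    rw [Finset.mul_sum]
    refine Finset.sum_congr rfl fun kI _ => ?_
    rw [hw, loopSum_glue hij, ψ_add]; ring
  have hlayer : ∑ kI : Site d L → ZMod N, (w kI : ℂ) * ψ N (rung x i j T R kI) =
      (FiniteGibbs.mass w : ℂ) * FiniteGibbs.cavg w (fun kI => ψ N (rung x i j T R kI)) := by
    rw [FiniteGibbs.cavg, mul_div_cancel₀]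
    rw [Ne, Complex.ofReal_eq_zero]; exact hwmass.ne'
  -- block conditioning on the unselected `i`-links
  have hblock : ‖FiniteGibbs.cavg w (fun kI => ψ N (rung x i j T R kI))‖ ≤ M :=
    ZNSpin.norm_cavg_le_of_piecewise (block i (selH x i m R)) (fun kI => (hwpos kI).le) hwmass _ fun κ _ =>
      norm_cavg_ψ_rung_piecewise_le hdep i j hij hwin x R T hR kT κ hN hB0 hB hrow hc1 hs hext hT
  rw [hfac, hlayer, norm_mul, norm_ψ, one_mul, norm_mul, Complex.norm_real, Real.norm_eq_abs, abs_of_pos hwmass]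
  have hmass_eq : FiniteGibbs.mass w = ∑ kI : Site d L → ZMod N, znWD g (glue i kI kT) := rfl
  rw [hmass_eq, mul_comm]
  exact mul_le_mul_of_nonneg_right hblock (Finset.sum_nonneg fun kI _ => (Real.exp_pos _).le)

/-- **At least `R/m` rungs are selected**: `R ≤ m · #selIdx m R` (`0 < m`). [folklore] -/
theorem le_mul_card_selIdx {m : ℕ} (hm : 0 < m) (R : ℕ) : R ≤ m * (selIdx m R).card := by
  classical
  -- the multiples `q·m`, `q < ⌈R/m⌉`, are selected
  set Q := (R + m - 1) / m with hQ
  have hsub : (Finset.range Q).image (fun q => q * m) ⊆ selIdx m R := by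
    intro r hr
    obtain ⟨q, hq, rfl⟩ := Finset.mem_image.1 hr
    rw [Finset.mem_range] at hq
    refine Finset.mem_filter.2 ⟨Finset.mem_range.2 ?_, Dvd.intro_left q rfl⟩
    have h1 : (q + 1) * m ≤ Q * m := Nat.mul_le_mul_right m hq
    have h2 : Q * m ≤ R + m - 1 := Nat.div_mul_le_self _ _
    rw [Nat.add_mul, one_mul] at h1
    omega
  have hcard : Q ≤ (selIdx m R).card := by
    calc Q = ((Finset.range Q).image (fun q => q * m)).card := by
          rw [Finset.card_image_of_injective _ fun a b h => Nat.eq_of_mul_eq_mul_right hm h, Finset.card_range]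
      _ ≤ (selIdx m R).card := Finset.card_le_card hsub
  have hQm : R ≤ m * Q := by
    have := Nat.lt_div_mul_add (a := R + m - 1) hm
    rw [← hQ] at this
    rw [mul_comm]; omega
  exact hQm.trans (Nat.mul_le_mul_left m hcard)

/-- The selected rungs are among the `R` rungs. [folklore] -/
theorem card_selIdx_le (m R : ℕ) : (selIdx m R).card ≤ R :=
  (Finset.card_filter_le _ _).trans (Finset.card_range R).le

end ZNFluxW

end Summit.Ventures.YMGap.RobustBall

end
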